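/-
Copyright (c) 2026 the pub-hodgecm-mathlib formalisation cell (harness21).  Prover seat hodgecm-mathlib-A-p19 (g21), D-T road (Tamagawa ∕ (K7-s)),
brick B2c «D-T3′-def, rational and conjugate frames» (offered on LEAD F0P3a-plan (g9)'s floor, 2026-09-01).
-/
import Literature.NumberTheory.Weil1964.UnitaryArchSingularCentralizerTopFormHaarFrames
import Literature.NumberTheory.Rogawski1990.GlobalTransferFactor
import Literature.NumberTheory.Automorphic.ArchCongruenceTransport
import HarnessLib

/-!
# Rational frames are archimedean frames: `centralizerTopFormHaar` at the rational singular classes, and transport of frames along form-preserving conjugation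
# (Rogawski 1990 §3.8 Prop. 3.8.1 (a); §1.7 p. 6)

Topic `NumberTheory/Weil1964`; namespace `Literature.NumberTheory.Weil1964.UnitaryArchTopForm`.  THEOREMS ONLY (no definition, no instance, no notation, no named fact,
no `sorry`) over ★ B2a∕B2b `UnitaryArchSingularCentralizerTopFormHaar(Frames)`, ★ `Rogawski1990/GlobalTransferFactor` (`cmRationalToArch`, `γ ↦ γ ⊗ 1`) and ★
`ArchCongruenceTransport` (`archFormOf_formCongr`).
Cell `pub/hodgecm-mathlib`, crux H413 = `stmt-HodgeConjecture-24833`; D-T road row «D-T3′», brick B2c: the SOCKET through which the (K7-s) ∕ (Q-∞) witness of the letter S1′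
(★ `Cruxes/H413/Lines/F0_P3a_SingularEllipticTransferPaydown`, classes `c` with `¬ IsRegularElt`, arch points `cmRationalToArch L 3 H′ γ₀`) evaluates the named measure.

* **`isSingularArchFrame_cmRationalToArch`** — the RATIONAL frame `(a, b, P, H_a, H_b)` of a singular semisimple non-scalar `γ₀ ∈ U(H)(L⁺)` (the nine facts of ★
  `exists_singular_frame_of_isSemisimpleElt` ∕ ★ `exists_frame_continuousMulEquiv_centralizer_toAdelic_of_singular`) IS a singular archimedean frame of `γ₀ ⊗ 1` with
  `T := P ⊗ 1` (★ `archFormOf_formCongr`); `exists_isSingularArchFrame_cmRationalToArch` (existence, from ★ `exists_singular_frame_of_isSemisimpleElt`);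
  **`centralizerTopFormHaar_cmRationalToArch_eq`** (the named measure at `γ₀ ⊗ 1` computed in the rational frame) and `isHaarMeasure_centralizerTopFormHaar_cmRationalToArch`.
* **`IsSingularArchFrame.conj_of_formCongr_eq`** — frames transport along `x = g γ g⁻¹` for `g ∈ GL₃(L ⊗ ℝ)` preserving `H′` (`T ↦ g T`); `IsSingularArchFrame.conj` for
  `g ∈ U(H)(L⁺ ⊗ ℝ)`.  NOT HERE: frames at GL-conjugates with OTHER block signatures (★ `Corresponds` = `IsConj` in `GL₃`; needs a rational form of prescribed signatures).
HONEST SCOPE.  Algebra over the ★ bricks; HC_CM is proved only modulo the printed citations until rung 0 closes; this file discharges no printed statement.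

## References
* J. D. Rogawski, *Automorphic Representations of Unitary Groups in Three Variables*, Ann. of Math. Stud. 123 (1990), §1.7 p. 6, §3.8 Prop. 3.8.1 (a) p. 27. [Rogawski1990]
* A. Borel, H. Jacquet, *Automorphic forms and automorphic representations*, PSPM 33.1 (1979), §4.1. [BorelJacquet1979]
-/

set_option autoImplicit false

noncomputable section

open NumberField NumberField.mixedEmbedding NumberField.InfinitePlace Set Filter Topology MeasureTheory MeasureTheory.Measure
open Literature.NumberTheory.Automorphic Literature.NumberTheory.Automorphic.UnitaryGroup Literature.NumberTheory.Rogawski1990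
open scoped Classical Matrix MatrixGroups ENNReal NNReal

namespace Literature.NumberTheory.Weil1964

namespace UnitaryArchTopForm

section Rational

variable {L : Type} [Field L] [NumberField L] [IsCMField L] {H : Matrix (Fin 3) (Fin 3) L}

/-- `cmConjRingHom` and `IsCMField.complexConj` agree as functions (★ `cmConjRingHom_apply`). [folklore] -/
private theorem map_cmConjRingHom_eq {m n : ℕ} (A : Matrix (Fin m) (Fin n) L) : A.map (cmConjRingHom L) = A.map (IsCMField.complexConj L) := rfl

/-- **THE RATIONAL FRAME IS AN ARCHIMEDEAN FRAME.**  For `γ₀ ∈ U(H)(L⁺)` with a rational singular frame — `a ≠ b`, `ᵗP̄ H P = H_a ⊕ᶠ H_b`, `γ₀ P = P (a·1 ⊕ᶠ b·1)`, `H_a, H_b`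
hermitian non-degenerate (the facts of ★ `exists_singular_frame_of_isSemisimpleElt`) — `(a, b, P ⊗ 1, H_a, H_b)` is a singular archimedean frame of `γ₀ ⊗ 1 = cmRationalToArch L 3 H γ₀`
(★ `archFormOf_formCongr`: `archFormOf (ᵗP̄ H P) = formCongr (c ⊗ 1) (P ⊗ 1) (archFormOf H)`). [cite: Rogawski1990, §3.8 Prop. 3.8.1 (a) p. 27] [cite: BorelJacquet1979, §4.1] -/
theorem isSingularArchFrame_cmRationalToArch (γ₀ : (cmDatum L 3 H).Rational) {a b : L} {P : GL (Fin 3) L} {H_a : Matrix (Fin 2) (Fin 2) L}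
    {H_b : Matrix (Fin 1) (Fin 1) L} (hab : a ≠ b)
    (hP : (((P : Matrix (Fin 3) (Fin 3) L)).map (cmConjRingHom L))ᵀ * H * (P : Matrix (Fin 3) (Fin 3) L) = finSum 2 1 H_a H_b)
    (hγ : ((γ₀.val : GL (Fin 3) L) : Matrix (Fin 3) (Fin 3) L) * (P : Matrix (Fin 3) (Fin 3) L) =
      (P : Matrix (Fin 3) (Fin 3) L) * finSum 2 1 (a • (1 : Matrix (Fin 2) (Fin 2) L)) (b • (1 : Matrix (Fin 1) (Fin 1) L)))
    (hHa : (H_a.map (cmConjRingHom L))ᵀ = H_a) (hHb : (H_b.map (cmConjRingHom L))ᵀ = H_b) (hda : H_a.det ≠ 0) (hdb : H_b.det ≠ 0) :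
    IsSingularArchFrame L H (cmRationalToArch L 3 H γ₀) a b (Matrix.GeneralLinearGroup.map (mixedEmbedding L) P) H_a H_b := by
  refine ⟨hab, ?_, ?_, isUnit_iff_ne_zero.2 hda, isUnit_iff_ne_zero.2 hdb, ?_, ?_⟩
  · rw [← map_cmConjRingHom_eq]; exact hHa
  · rw [← map_cmConjRingHom_eq]; exact hHb
  · -- the form equation: `archFormOf (formCongr c P H) = formCongr (c ⊗ 1) (P ⊗ 1) (archFormOf H)`
    have hP' : formCongr (cmConjRingHom L) P H = finSum 2 1 H_a H_b := hP
    rw [← archFormOf_formCongr L P H, hP']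
  · -- the eigen-equation, entrywise image of the rational one under `mixedEmbedding`
    have hγm : (((cmRationalToArch L 3 H γ₀ : arch (↥(maximalRealSubfield L)) L (IsCMField.complexConj L) 3 H) : GL (Fin 3) (mixedSpace L)) :
        Matrix (Fin 3) (Fin 3) (mixedSpace L)) = (((γ₀.val : GL (Fin 3) L) : Matrix (Fin 3) (Fin 3) L)).map (mixedEmbedding L) := rfl
    have hPm : ((Matrix.GeneralLinearGroup.map (mixedEmbedding L) P : GL (Fin 3) (mixedSpace L)) : Matrix (Fin 3) (Fin 3) (mixedSpace L)) =
        (P : Matrix (Fin 3) (Fin 3) L).map (mixedEmbedding L) := rfl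
    rw [hγm, hPm, ← Matrix.map_mul, hγ, Matrix.map_mul, finSum_map, Matrix.map_smul' _ _ _ (map_mul (mixedEmbedding L)),
      Matrix.map_smul' _ _ _ (map_mul (mixedEmbedding L)), Matrix.map_one (mixedEmbedding L) (map_zero _) (map_one _),
      Matrix.map_one (mixedEmbedding L) (map_zero _) (map_one _)]

/-- **Every singular semisimple non-scalar rational element has an archimedean frame at `γ₀ ⊗ 1`** (★ `exists_singular_frame_of_isSemisimpleElt` + the previous lemma).
[cite: Rogawski1990, §3.8 Prop. 3.8.1 (a) p. 27] -/
theorem exists_isSingularArchFrame_cmRationalToArch (hH : (H.map (cmConjRingHom L))ᵀ = H) (hdet : H.det ≠ 0) (γ₀ : (cmDatum L 3 H).Rational)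
    (hss : Rogawski1990.IsSemisimpleElt (cmConjRingHom L) H γ₀) (hnreg : ¬ IsRegularElt (γ₀.val : GL (Fin 3) L))
    (hnsc : ∀ ζ : L, ((γ₀.val : GL (Fin 3) L) : Matrix (Fin 3) (Fin 3) L) ≠ ζ • 1) :
    ∃ (a b : L) (T : GL (Fin 3) (mixedSpace L)) (H_a : Matrix (Fin 2) (Fin 2) L) (H_b : Matrix (Fin 1) (Fin 1) L),
      IsSingularArchFrame L H (cmRationalToArch L 3 H γ₀) a b T H_a H_b := by
  obtain ⟨a, b, P, Ha, Hb, hab, -, -, hP, hγP, hHa, hHb, hda, hdb⟩ :=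
    exists_singular_frame_of_isSemisimpleElt (cmConjRingHom L) (fun x => by
      rw [cmConjRingHom_apply, cmConjRingHom_apply]; exact IsCMField.complexConj_apply_apply L x) H hH hdet γ₀ hss hnreg hnsc
  exact ⟨a, b, _, Ha, Hb, isSingularArchFrame_cmRationalToArch γ₀ hab hP hγP hHa hHb hda hdb⟩

/-- **`centralizerTopFormHaar` AT A RATIONAL SINGULAR CLASS, COMPUTED IN THE RATIONAL FRAME**: for the rational frame `(a, b, P, H_a, H_b)` of `γ₀`,
`centralizerTopFormHaar L H (γ₀ ⊗ 1) = (P ⊗ 1)_* (archTopFormHaar H_a ⊗ archTopFormHaar H_b)` on `Z(γ₀ ⊗ 1)` (★ `centralizerTopFormHaar_eq_centralizerMeasureOfFrame`) — the socket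
of the (K7-s) ∕ (Q-∞) witness. [cite: Rogawski1990, §1.7 p. 6; §3.8 Prop. 3.8.1 (a) p. 27] -/
theorem centralizerTopFormHaar_cmRationalToArch_eq (γ₀ : (cmDatum L 3 H).Rational) {a b : L} {P : GL (Fin 3) L} {H_a : Matrix (Fin 2) (Fin 2) L}
    {H_b : Matrix (Fin 1) (Fin 1) L} (hab : a ≠ b)
    (hP : (((P : Matrix (Fin 3) (Fin 3) L)).map (cmConjRingHom L))ᵀ * H * (P : Matrix (Fin 3) (Fin 3) L) = finSum 2 1 H_a H_b)
    (hγ : ((γ₀.val : GL (Fin 3) L) : Matrix (Fin 3) (Fin 3) L) * (P : Matrix (Fin 3) (Fin 3) L) =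
      (P : Matrix (Fin 3) (Fin 3) L) * finSum 2 1 (a • (1 : Matrix (Fin 2) (Fin 2) L)) (b • (1 : Matrix (Fin 1) (Fin 1) L)))
    (hHa : (H_a.map (cmConjRingHom L))ᵀ = H_a) (hHb : (H_b.map (cmConjRingHom L))ᵀ = H_b) (hda : H_a.det ≠ 0) (hdb : H_b.det ≠ 0)
    [MeasurableSpace (Subgroup.centralizer ({cmRationalToArch L 3 H γ₀} : Set (arch (↥(maximalRealSubfield L)) L (IsCMField.complexConj L) 3 H)))]
    [BorelSpace (Subgroup.centralizer ({cmRationalToArch L 3 H γ₀} : Set (arch (↥(maximalRealSubfield L)) L (IsCMField.complexConj L) 3 H)))]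
    [MeasurableSpace (arch (↥(maximalRealSubfield L)) L (IsCMField.complexConj L) 2 H_a)] [BorelSpace (arch (↥(maximalRealSubfield L)) L (IsCMField.complexConj L) 2 H_a)]
    [MeasurableSpace (archSkew (↥(maximalRealSubfield L)) L (IsCMField.complexConj L) 2 H_a)] [BorelSpace (archSkew (↥(maximalRealSubfield L)) L (IsCMField.complexConj L) 2 H_a)]
    [MeasurableSpace (arch (↥(maximalRealSubfield L)) L (IsCMField.complexConj L) 1 H_b)] [BorelSpace (arch (↥(maximalRealSubfield L)) L (IsCMField.complexConj L) 1 H_b)]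
    [MeasurableSpace (archSkew (↥(maximalRealSubfield L)) L (IsCMField.complexConj L) 1 H_b)] [BorelSpace (archSkew (↥(maximalRealSubfield L)) L (IsCMField.complexConj L) 1 H_b)] :
    centralizerTopFormHaar L H (cmRationalToArch L 3 H γ₀) =
      centralizerMeasureOfFrame (N₁ := 2) (N₂ := 1) (Matrix.GeneralLinearGroup.map (mixedEmbedding L) P)
        (isSingularArchFrame_cmRationalToArch γ₀ hab hP hγ hHa hHb hda hdb).formCongr_eq (cmRationalToArch L 3 H γ₀)
        (isSingularArchFrame_cmRationalToArch γ₀ hab hP hγ hHa hHb hda hdb).mul_eq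
        (archTopFormHaar (↥(maximalRealSubfield L)) L (IsCMField.complexConj L) 2 H_a) (archTopFormHaar (↥(maximalRealSubfield L)) L (IsCMField.complexConj L) 1 H_b) :=
  centralizerTopFormHaar_eq_centralizerMeasureOfFrame (isSingularArchFrame_cmRationalToArch γ₀ hab hP hγ hHa hHb hda hdb)

/-- **`centralizerTopFormHaar (γ₀ ⊗ 1)` is a Haar measure on `Z(γ₀ ⊗ 1)`** for every singular semisimple non-scalar `γ₀ ∈ U(H)(L⁺)`.
[cite: Rogawski1990, §1.7 p. 6; §3.8 Prop. 3.8.1 (a) p. 27] -/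
theorem isHaarMeasure_centralizerTopFormHaar_cmRationalToArch (hH : (H.map (cmConjRingHom L))ᵀ = H) (hdet : H.det ≠ 0) (γ₀ : (cmDatum L 3 H).Rational)
    (hss : Rogawski1990.IsSemisimpleElt (cmConjRingHom L) H γ₀) (hnreg : ¬ IsRegularElt (γ₀.val : GL (Fin 3) L))
    (hnsc : ∀ ζ : L, ((γ₀.val : GL (Fin 3) L) : Matrix (Fin 3) (Fin 3) L) ≠ ζ • 1)
    [MeasurableSpace (Subgroup.centralizer ({cmRationalToArch L 3 H γ₀} : Set (arch (↥(maximalRealSubfield L)) L (IsCMField.complexConj L) 3 H)))]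
    [BorelSpace (Subgroup.centralizer ({cmRationalToArch L 3 H γ₀} : Set (arch (↥(maximalRealSubfield L)) L (IsCMField.complexConj L) 3 H)))] :
    (centralizerTopFormHaar L H (cmRationalToArch L 3 H γ₀)).IsHaarMeasure := by
  obtain ⟨a, b, T, Ha, Hb, h⟩ := exists_isSingularArchFrame_cmRationalToArch hH hdet γ₀ hss hnreg hnsc
  exact isHaarMeasure_centralizerTopFormHaar h

end Rational

/-! ## Transport of frames along form-preserving conjugation -/

section Conj

variable {L : Type} [Field L] [NumberField L] [IsCMField L] {H : Matrix (Fin 3) (Fin 3) L}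

/-- **Frames transport along form-preserving conjugation**: if `(a, b, T, H_a, H_b)` is a frame of `γ` and `g ∈ GL₃(L ⊗ ℝ)` preserves `H′` (`σ(g)ᵀ H′ g = H′`) with `x g = g γ`
(`x = g γ g⁻¹`), then `(a, b, g T, H_a, H_b)` is a frame of `x` (★ `formCongr_mul_eq`). [cite: Rogawski1990, §3.8 Prop. 3.8.1 (a) p. 27] -/
theorem IsSingularArchFrame.conj_of_formCongr_eq {γ x : arch (↥(maximalRealSubfield L)) L (IsCMField.complexConj L) 3 H} {a b : L} {T : GL (Fin 3) (mixedSpace L)}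
    {H_a : Matrix (Fin 2) (Fin 2) L} {H_b : Matrix (Fin 1) (Fin 1) L} (h : IsSingularArchFrame L H γ a b T H_a H_b) (g : GL (Fin 3) (mixedSpace L))
    (hg : formCongr (conjMixed (↥(maximalRealSubfield L)) L (IsCMField.complexConj L)) g (archFormOf L 3 H) = archFormOf L 3 H)
    (hx : ((x : GL (Fin 3) (mixedSpace L)) : Matrix (Fin 3) (Fin 3) (mixedSpace L)) * (g : Matrix (Fin 3) (Fin 3) (mixedSpace L)) =
      (g : Matrix (Fin 3) (Fin 3) (mixedSpace L)) * ((γ : GL (Fin 3) (mixedSpace L)) : Matrix (Fin 3) (Fin 3) (mixedSpace L))) :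
    IsSingularArchFrame L H x a b (g * T) H_a H_b := by
  refine ⟨h.1, h.2.1, h.2.2.1, h.2.2.2.1, h.2.2.2.2.1, ?_, ?_⟩
  · rw [formCongr_mul_eq, hg, h.formCongr_eq]
  · rw [Units.val_mul, ← Matrix.mul_assoc, hx, Matrix.mul_assoc, h.mul_eq, Matrix.mul_assoc]

/-- **Frames transport along conjugation in `U(H)(L⁺ ⊗ ℝ)`**: a frame of `γ` with `T` gives a frame of `y γ y⁻¹` with `y T`. [cite: Rogawski1990, §3.8 Prop. 3.8.1 (a) p. 27] -/
theorem IsSingularArchFrame.conj {γ : arch (↥(maximalRealSubfield L)) L (IsCMField.complexConj L) 3 H} {a b : L} {T : GL (Fin 3) (mixedSpace L)}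
    {H_a : Matrix (Fin 2) (Fin 2) L} {H_b : Matrix (Fin 1) (Fin 1) L} (h : IsSingularArchFrame L H γ a b T H_a H_b)
    (y : arch (↥(maximalRealSubfield L)) L (IsCMField.complexConj L) 3 H) :
    IsSingularArchFrame L H (y * γ * y⁻¹) a b ((y : GL (Fin 3) (mixedSpace L)) * T) H_a H_b := by
  refine h.conj_of_formCongr_eq (y : GL (Fin 3) (mixedSpace L)) (mem_unitaryGroupOfForm_iff.1 y.2) ?_
  have hGL : ((y * γ * y⁻¹ : arch (↥(maximalRealSubfield L)) L (IsCMField.complexConj L) 3 H) : GL (Fin 3) (mixedSpace L)) * (y : GL (Fin 3) (mixedSpace L)) =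
      (y : GL (Fin 3) (mixedSpace L)) * (γ : GL (Fin 3) (mixedSpace L)) := by
    rw [Subgroup.coe_mul, Subgroup.coe_mul, Subgroup.coe_inv, inv_mul_cancel_right]
  have h2 := congrArg (fun g : GL (Fin 3) (mixedSpace L) => (g : Matrix (Fin 3) (Fin 3) (mixedSpace L))) hGL
  simpa only [Units.val_mul] using h2

end Conj

end UnitaryArchTopForm

end Literature.NumberTheory.Weil1964

end
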